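import Mathlib
import Summits.Ventures.PercRepro2.MixChordCoincidence
import Summits.Ventures.PercRepro2.HMFRootEdgeChordTheorem
import Summits.Ventures.PercRepro2.A3Inactive

/-!
# The half-chord along a root edge to `o` when `a₃` is inactive — the first kernel instance of the
coincidence class (blind cell PercRepro2, night-1 g19; proofs/NIGHT1-G19.md §3′)

Along `f = {o, a₁}` with `a₃` inactive (no configuration joins `a₃` to a root, mine-2's
hypothesis), `PD = Q`, `Gc = 2 Z·S` with `S = P(Q,bL)P(Q,oH) − Z P(Q,oH,bL) + P(Q,bH)P(Q,oL) −
Z P(Q,oL,bH)` (`A3Inactive.Gc_eq_of_a3Inactive`), and the half-chord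
`(1 − q)·(Z/Z⁰)²·Gc⁰ ≤ Gc` clears to `(1 − q)·Z·S⁰ ≤ Z⁰·S`.  With the coupling across `f`
(`Q¹ = Q ∩ {o ∉ C₂}`: `Z¹ = Z⁰ − H⁰`, `B¹ = B⁰ − HB⁰`, `L¹ ≥ L⁰ − LH⁰`, `H¹ = LH¹ = 0`, `O¹ = Z¹`,
`BO¹ = B¹`, g18's `RootEdge.prob_Q_update_one` / `prob_Q_conn2_update_one` /
`prob_Q_conn1_update_one_ge` read for the far end `o`) the cleared difference is the EXACT identity

`Z⁰·S − (1 − q)·Z·S⁰ = q(1 − q)·(X·H⁰ − Y·N)`,  `X = Z⁰L¹ − Z¹L⁰`, `Y = Z⁰B¹ − Z¹B⁰`, `N = Z⁰ − O⁰`,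

and `X ≥ 0` (the cross-cluster BHK `Q_mul_TbL_le`), `Y ≤ 0` (the same-cluster BHK `T_mul_QbH_le`),
`H⁰, N ≥ 0` — the exploration-martingale proof (`T_Q + T_PD ≥ 0`, `T_γ = 0`) in cleared form.
**`halfChord_o_edge_of_a3Inactive`**.

Own code; standard axioms.
-/

namespace Summit.Ventures.PercRepro2

open UnionCluster CovForm

namespace Mix

section OInactive

variable {V : Type*} {E : Type*} [Fintype E] [DecidableEq E] [Fintype V] [DecidableEq V]
  {R : Type*} [Field R] [LinearOrder R] [IsStrictOrderedRing R]

variable (p : E → R) (ends : E → Sym2 V) {o a₁ a₂ a₃ : V} (b : V) {f : E}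

omit [Fintype E] [DecidableEq E] [Fintype V] [DecidableEq V] [LinearOrder R] [IsStrictOrderedRing R] in
/-- `T_o ∩ X = Q ∩ ({a₂ ↔ o} ∩ X)`. -/
lemma TEvent_o_inter (X : Set (Config E)) :
    TEvent ends a₁ a₂ o ∩ X = avoidAll ends a₂ {a₁} ∩ (connEvent ends a₂ o ∩ X) := by
  ext ω
  simp only [TEvent, mem_avoidAll, Finset.mem_singleton, forall_eq, Set.mem_inter_iff,
    Set.mem_compl_iff, mem_connEvent]
  tauto

omit [Fintype E] [DecidableEq E] [Fintype V] [DecidableEq V] [LinearOrder R] [IsStrictOrderedRing R] in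
/-- `T_o = Q ∩ {a₂ ↔ o}`. -/
lemma TEvent_o : TEvent ends a₁ a₂ o = avoidAll ends a₂ {a₁} ∩ connEvent ends a₂ o := by
  have := TEvent_o_inter ends (o := o) (a₁ := a₁) (a₂ := a₂) Set.univ
  simpa only [Set.inter_univ] using this

omit [Fintype V] [DecidableEq V] in
/-- On the support of `p[f ↦ 1]`, `a₁ ↔ o`. -/
lemma conn_a1_o_of_update_one (hf : ends f = s(o, a₁)) :
    ∀ ω, weight (Function.update p f 1) ω ≠ 0 → Conn ends ω a₁ o := fun _ hω =>
  conn_symm (conn_of_openAdj ⟨f, eq_true_of_weight_update_one_ne_zero hω, hf⟩)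

omit [Fintype E] [DecidableEq E] [Fintype V] [DecidableEq V] [LinearOrder R] [IsStrictOrderedRing R] in
/-- The cleared identity of the half-chord along `{o, a₁}` with `a₃` inactive, in abstract
variables: `Z⁰·S − (1 − q)·Z·S⁰ = q(1 − q)·(X·H⁰ − Y·N)` (`Z¹ = Z⁰ − H⁰`, `B¹ = B⁰ − HB⁰`,
`H¹ = LH¹ = 0`, `O¹ = Z¹`, `BO¹ = B¹`). -/
lemma o_key (q Z0 Z1 L0 L1 B0 B1 H0 LH0 O0 BO0 HB0 : R) (hZ1 : Z1 = Z0 - H0) (hB1 : B1 = B0 - HB0) :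
    Z0 * (((q * L1 + (1 - q) * L0) * (q * 0 + (1 - q) * H0) -
          (q * Z1 + (1 - q) * Z0) * (q * 0 + (1 - q) * LH0)) +
        ((q * B1 + (1 - q) * B0) * (q * Z1 + (1 - q) * O0) -
          (q * Z1 + (1 - q) * Z0) * (q * B1 + (1 - q) * BO0))) -
      (1 - q) * (q * Z1 + (1 - q) * Z0) *
        ((L0 * H0 - Z0 * LH0) + (B0 * O0 - Z0 * BO0)) =
      q * (1 - q) * ((Z0 * L1 - Z1 * L0) * H0 - (Z0 * B1 - Z1 * B0) * (Z0 - O0)) := by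
  subst hZ1 hB1
  ring

omit [Fintype E] [DecidableEq E] [Fintype V] [DecidableEq V] in
/-- `X ≥ 0`, `Y ≤ 0`, `H, N ≥ 0` give `X·H − Y·N ≥ 0`. -/
lemma o_sign (X Y H N : R) (hX : 0 ≤ X) (hY : Y ≤ 0) (hH : 0 ≤ H) (hN : 0 ≤ N) :
    0 ≤ X * H - Y * N := by
  nlinarith [mul_nonneg hX hH, mul_nonneg (neg_nonneg.2 hY) hN]

omit [Fintype E] [DecidableEq E] [Fintype V] [DecidableEq V] in
/-- From the cleared inequality to the half-chord: `(1 − q)·(Z²/Z⁰²)·2Z⁰S⁰ ≤ 2ZS`. -/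
lemma o_final (q Z Z0 S S0 : R) (hZ : 0 ≤ Z) (hZ0 : 0 < Z0)
    (hkey : 0 ≤ Z0 * S - (1 - q) * Z * S0) :
    (1 - q) * (Z * Z / (Z0 * Z0) * (2 * Z0 * S0)) ≤ 2 * Z * S := by
  have h : (1 - q) * (Z * Z / (Z0 * Z0) * (2 * Z0 * S0)) = 2 * (1 - q) * Z * Z * S0 / Z0 := by
    field_simp
  rw [h, div_le_iff₀ hZ0]
  nlinarith [mul_nonneg (mul_nonneg hZ hZ0.le) hkey]

set_option maxHeartbeats 400000 in
/-- **The half-chord along `f = {o, a₁}` when `a₃` is inactive.** -/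
theorem halfChord_o_edge_of_a3Inactive (hp : IsProbVec p) (hf : ends f = s(o, a₁))
    (hin : ∀ ω : Config E, ¬ Conn ends ω a₁ a₃ ∧ ¬ Conn ends ω a₂ a₃) :
    HalfChord p ends o a₁ a₂ a₃ b f := by
  have hp0 : IsProbVec (Function.update p f 0) := hp.update f le_rfl zero_le_one
  have hp1 : IsProbVec (Function.update p f 1) := hp.update f zero_le_one le_rfl
  have hq0 := hp.nonneg f
  have hq1 := hp.le_one f
  have hc1 := conn_a1_o_of_update_one p ends hf
  unfold HalfChord shrink
  rw [A3Inactive.PDEvent_eq_Q hin, A3Inactive.Gc_eq_of_a3Inactive p ends o a₁ a₂ a₃ b hin,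
    A3Inactive.Gc_eq_of_a3Inactive (Function.update p f 0) ends o a₁ a₂ a₃ b hin]
  -- nonnegativity of the masses
  have hZ0 := prob_nonneg hp0 (avoidAll ends a₂ {a₁})
  have hZ := prob_nonneg hp (avoidAll ends a₂ {a₁})
  have hH0 := prob_nonneg hp0 (avoidAll ends a₂ {a₁} ∩ connEvent ends a₂ o)
  have hO0le := prob_inter_le_left hp0 (avoidAll ends a₂ {a₁}) (connEvent ends a₁ o)
  -- (HCOV) at `p` and at `p[f ↦ 0]` (mine-2), for the degenerate cases
  have hS : 0 ≤ Gc p ends o a₁ a₂ a₃ b := A3Inactive.HCov_of_a3Inactive p hp ends o a₁ a₂ a₃ b hin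
  rw [A3Inactive.Gc_eq_of_a3Inactive p ends o a₁ a₂ a₃ b hin] at hS
  -- the coupling across `f` (g18's lemmas with the far end `o`)
  have hZ1 := RootEdge.prob_Q_update_one p ends (a₂ := a₂) hf
  rw [TEvent_o] at hZ1
  have hB1 := RootEdge.prob_Q_conn2_update_one p ends (a₂ := a₂) hf b
  rw [TEvent_o_inter] at hB1
  have hL1 := RootEdge.prob_Q_conn1_update_one_ge p ends (a₂ := a₂) hp hf b
  rw [TEvent_o_inter] at hL1
  have hH1 : prob (Function.update p f 1) (avoidAll ends a₂ {a₁} ∩ connEvent ends a₂ o) = 0 :=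
    prob_Q_conn₂_eq_zero _ ends hc1
  have hLH1 : prob (Function.update p f 1)
      (avoidAll ends a₂ {a₁} ∩ (connEvent ends a₂ o ∩ connEvent ends a₁ b)) = 0 :=
    prob_inter_conn₂_eq_zero _ ends hc1 _ _ le_rfl
  have hO1 : prob (Function.update p f 1) (avoidAll ends a₂ {a₁} ∩ connEvent ends a₁ o) =
      prob (Function.update p f 1) (avoidAll ends a₂ {a₁}) :=
    prob_inter_conn_eq' _ ends hc1 _
  have hBO1 : prob (Function.update p f 1)
      (avoidAll ends a₂ {a₁} ∩ (connEvent ends a₁ o ∩ connEvent ends a₂ b)) =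
      prob (Function.update p f 1) (avoidAll ends a₂ {a₁} ∩ connEvent ends a₂ b) :=
    prob_inter_conn_eq _ ends hc1 _ _
  -- the two BHK inequalities at `p[f ↦ 0]` with the far end `o`
  have hbhk1 := RootEdge.T_mul_QbH_le (Function.update p f 0) ends b hp0 (a₁ := a₁) (a₂ := a₂) (a₃ := o)
  rw [TEvent_o_inter, TEvent_o] at hbhk1
  have hbhk2 := RootEdge.Q_mul_TbL_le (Function.update p f 0) ends b hp0 (a₁ := a₁) (a₂ := a₂) (a₃ := o)
  rw [TEvent_o_inter, TEvent_o] at hbhk2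
  -- the masses at `p` are mixtures
  have pQ := prob_eq_pin p (avoidAll ends a₂ {a₁}) f
  have pL := prob_eq_pin p (avoidAll ends a₂ {a₁} ∩ connEvent ends a₁ b) f
  have pH := prob_eq_pin p (avoidAll ends a₂ {a₁} ∩ connEvent ends a₂ o) f
  have pLH := prob_eq_pin p (avoidAll ends a₂ {a₁} ∩ (connEvent ends a₂ o ∩ connEvent ends a₁ b)) f
  have pB := prob_eq_pin p (avoidAll ends a₂ {a₁} ∩ connEvent ends a₂ b) f
  have pO := prob_eq_pin p (avoidAll ends a₂ {a₁} ∩ connEvent ends a₁ o) f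
  have pBO := prob_eq_pin p (avoidAll ends a₂ {a₁} ∩ (connEvent ends a₁ o ∩ connEvent ends a₂ b)) f
  rw [hH1, hLH1, hO1, hBO1] at *
  -- the signed pieces
  have hX : 0 ≤ prob (Function.update p f 0) (avoidAll ends a₂ {a₁}) *
      prob (Function.update p f 1) (avoidAll ends a₂ {a₁} ∩ connEvent ends a₁ b) -
      prob (Function.update p f 1) (avoidAll ends a₂ {a₁}) *
      prob (Function.update p f 0) (avoidAll ends a₂ {a₁} ∩ connEvent ends a₁ b) := by
    rw [hZ1]
    nlinarith [mul_le_mul_of_nonneg_left hL1 hZ0, hbhk2]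
  have hY : prob (Function.update p f 0) (avoidAll ends a₂ {a₁}) *
      prob (Function.update p f 1) (avoidAll ends a₂ {a₁} ∩ connEvent ends a₂ b) -
      prob (Function.update p f 1) (avoidAll ends a₂ {a₁}) *
      prob (Function.update p f 0) (avoidAll ends a₂ {a₁} ∩ connEvent ends a₂ b) ≤ 0 := by
    rw [hZ1, hB1]
    nlinarith [hbhk1]
  have hN : 0 ≤ prob (Function.update p f 0) (avoidAll ends a₂ {a₁}) -
      prob (Function.update p f 0) (avoidAll ends a₂ {a₁} ∩ connEvent ends a₁ o) := by linarith
  have hsign := o_sign _ _ _ _ hX hY hH0 hN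
  have hid := o_key (p f) (prob (Function.update p f 0) (avoidAll ends a₂ {a₁}))
    (prob (Function.update p f 1) (avoidAll ends a₂ {a₁}))
    (prob (Function.update p f 0) (avoidAll ends a₂ {a₁} ∩ connEvent ends a₁ b))
    (prob (Function.update p f 1) (avoidAll ends a₂ {a₁} ∩ connEvent ends a₁ b))
    (prob (Function.update p f 0) (avoidAll ends a₂ {a₁} ∩ connEvent ends a₂ b))
    (prob (Function.update p f 1) (avoidAll ends a₂ {a₁} ∩ connEvent ends a₂ b))
    (prob (Function.update p f 0) (avoidAll ends a₂ {a₁} ∩ connEvent ends a₂ o))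
    (prob (Function.update p f 0) (avoidAll ends a₂ {a₁} ∩ (connEvent ends a₂ o ∩ connEvent ends a₁ b)))
    (prob (Function.update p f 0) (avoidAll ends a₂ {a₁} ∩ connEvent ends a₁ o))
    (prob (Function.update p f 0) (avoidAll ends a₂ {a₁} ∩ (connEvent ends a₁ o ∩ connEvent ends a₂ b)))
    (prob (Function.update p f 0) (avoidAll ends a₂ {a₁} ∩ (connEvent ends a₂ o ∩ connEvent ends a₂ b)))
    hZ1 hB1
  -- the masses at `p` are mixtures; the `p[f ↦ 1]` masses are their coupled values
  rw [pQ, pL, pH, pLH, pB, pO, pBO]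
  have h1q : 0 ≤ 1 - p f := by linarith
  by_cases hZ0z : prob (Function.update p f 0) (avoidAll ends a₂ {a₁}) = 0
  · -- `Z⁰ = 0`: the left side vanishes, the right side is (HCOV) at `p`
    rw [pQ, pL, pH, pLH, pB, pO, pBO] at hS
    rw [hZ0z] at hS ⊢
    simp only [mul_zero, zero_mul, div_zero, zero_add, sub_zero]
    simpa only [hZ0z, mul_zero, zero_mul, zero_add, sub_zero] using hS
  · have hZ0pos : 0 < prob (Function.update p f 0) (avoidAll ends a₂ {a₁}) :=
      lt_of_le_of_ne hZ0 (Ne.symm hZ0z)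
    refine o_final (p f) _ _ _ _ ?_ hZ0pos ?_
    · rw [← pQ]; exact hZ
    · have hpos : 0 ≤ p f * (1 - p f) *
          ((prob (Function.update p f 0) (avoidAll ends a₂ {a₁}) *
              prob (Function.update p f 1) (avoidAll ends a₂ {a₁} ∩ connEvent ends a₁ b) -
            prob (Function.update p f 1) (avoidAll ends a₂ {a₁}) *
              prob (Function.update p f 0) (avoidAll ends a₂ {a₁} ∩ connEvent ends a₁ b)) *
            prob (Function.update p f 0) (avoidAll ends a₂ {a₁} ∩ connEvent ends a₂ o) -
          (prob (Function.update p f 0) (avoidAll ends a₂ {a₁}) *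
              prob (Function.update p f 1) (avoidAll ends a₂ {a₁} ∩ connEvent ends a₂ b) -
            prob (Function.update p f 1) (avoidAll ends a₂ {a₁}) *
              prob (Function.update p f 0) (avoidAll ends a₂ {a₁} ∩ connEvent ends a₂ b)) *
            (prob (Function.update p f 0) (avoidAll ends a₂ {a₁}) -
              prob (Function.update p f 0) (avoidAll ends a₂ {a₁} ∩ connEvent ends a₁ o))) :=
        mul_nonneg (mul_nonneg hq0 h1q) hsign
      linarith [hid, hpos]

end OInactive

end Mix

end Summit.Ventures.PercRepro2
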